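import Summits.ABC.IUTFork.Cor312VolumesRealFrames
import HarnessLib

/-!
# [IUTchIII] Corollary 3.12, statement — the local `−|log(Θ)|` of the per-place real setting in CLOSED FORM

Record-only file (D-0012) of the abc-iut cell (Cor. 3.12 sub-crew, wave 2, seat abc-iut-c312-6, board row W2-C′);
TAKES NO SIDE. Theorems only. `Cor312VolumesRealFrames` gives the volumes of c312-7's per-place assembler
`Setting.ofFrames` and the local `−|log(Θ)|` "given the hull-set that is the hull" (`thetaLocal_ofFrames_of_hull_eq`).
This file removes that proviso for the two frames c312-7 actually uses, both of which have as hull S2's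
`holomorphicHull` = the polydisc of the radii `sup_{u} ‖u_i‖` (`HullFrame.ofLocalFields_hull_eq` at nonarchimedean
`v_ℚ`, `HullFrame.ofNormSurjective_hull_eq` at the archimedean one): under `HullDefined`,

  `thetaLocal j v_ℚ = Σ_i w_i · μ^log_{K_i}( B(0, sup_{u ∈ e(⋃ possible images)} ‖u_i‖) )`

— the printed "procession-normalized mono-analytic log-volume of the holomorphic hull of the union of the possible
images of a Θ-pilot object" ([IUTchIII] Cor. 3.12, kurims `paper:url-4b091feeb646` p. 173 l. 43 – p. 174 l. 3; proof
p. 174 l. 50 – p. 175 l. 1 "the holomorphic hull … of the union … of possible images"; Rmk. 3.9.5 (i) p. 127 "the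
smallest subset of the form `λ·𝒪_{(−)}` that contains" it), packet by packet, as an explicit finite sum over the field
factors at EVERY place:

* `thetaLocal_ofFrames_of_hull_eq_polydisc` — for any frame whose hull of the image is a polydisc `Π_i B(0, r_i)`;
* `thetaLocal_ofFrames_ofLocalFields` — `frameK = ofLocalFields` (nonarchimedean packets), `r = hullRadius`;
* `thetaLocal_ofFrames_ofNormSurjective` — `frameK = ofNormSurjective` (archimedean packets), `r = hullRadius`.

[claim: Mochizuki2012, status: disputed] for the quoted nouns; the content is bookkeeping over S2's hull. Deliberately
NOT here: whether `HullDefined` holds (Team A A-0 / c312-7 `Cor312StatementStability`), any judgement.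
-/

noncomputable section

open Set Metric

namespace Summit.ABC

namespace IUTFork

namespace Cor312Vol

namespace FrameVolumePieces

open Thm311 Cor312 Literature.IUT.LogVolume Literature.IUT.LogThetaLattice

variable {T : ThetaIndex} {S : Situation T} {V : FrameVolumePieces S.L} {n : ℤ}
variable {HT : Type} {LogLink : HT → HT → Type} {IsFull : ∀ {s t : HT}, LogLink s t → Prop}
  (lat : LGPGaussianLogThetaLattice LogLink IsFull)
  {Frd : Type} {IsoF : Frd → Frd → Type} {Ob : Frd → Type} {realify : Frd → Frd} {Strip : Type}
  {IsoS : Strip → Strip → Type} {M : ∀ v : T.V, v ∈ T.Vbad → Type} [∀ v h, Monoid (M v h)]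
  (sig : GlobalLGPFrobenioidSignature T.lstar T.V (· ∈ T.Vbad) Frd IsoF Ob realify Strip IsoS M)
  (split : SplittingMonoids M) {ObΔ : Type} {N : ∀ v : T.V, v ∈ T.Vbad → Type} [∀ v h, Monoid (N v h)]
  (qData : QPilotData ObΔ N)
  (thetaBox : ℤ → Ob sig.Clgp → ∀ j vQ, Set (∀ i, V.K j vQ i))
  (qCentre : ObΔ → ∀ j vQ, ∀ i, V.K j vQ i)
  (hq : ∀ j vQ i, qCentre (qPilotObject qData) j vQ i ≠ 0)
  (hadm : ∀ j vQ (H : Set (∀ i, V.K j vQ i)), IsHullSet (V.K j vQ) H → (S.D n).Adm j vQ (V.e j vQ ⁻¹' H))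
  (hfin : ∀ j : T.Label, (Function.support fun vQ => (S.D n).logvol j vQ
    (V.e j vQ ⁻¹' hullSet (V.K j vQ) (qCentre (qPilotObject qData) j vQ))).Finite)

/-- **Local `−|log(Θ)|` for a polydisc hull**: if (under `HullDefined`) the frame's hull of the image of the union
of the possible images is the polydisc `Π_i B(0, r_i)` (`r_i ≥ 0`), then
`thetaLocal j v_ℚ = Σ_i w_i·μ^log_{K_i}(B(0, r_i))`. [claim: Mochizuki2012, status: disputed] -/
theorem thetaLocal_ofFrames_of_hull_eq_polydisc (hV : V.Realizes (S.D n)) (j : T.Label) (vQ : T.VQ)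
    (h : (Setting.ofFrames n lat sig split qData (V.toRealFrames thetaBox qCentre) hq hadm hfin).HullDefined j vQ)
    (r : V.J j vQ → ℝ) (hr : ∀ i, 0 ≤ r i)
    (hhull : (V.frameK j vQ).hull (V.e j vQ '' ⋃₀ (Setting.ofFrames n lat sig split qData
      (V.toRealFrames thetaBox qCentre) hq hadm hfin).possibleImages j vQ) = polydisc (V.K j vQ) r) :
    (Setting.ofFrames n lat sig split qData (V.toRealFrames thetaBox qCentre) hq hadm hfin).thetaLocal j vQ =
      ((∑ i, V.w j vQ i * (V.vol j vQ i).logvol (closedBall 0 (r i)) : ℝ) : WithTop ℝ) := by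
  unfold Setting.thetaLocal
  rw [if_pos h]
  congr 1
  have hb : (V.frameK j vQ).IsBounded (V.e j vQ '' ⋃₀ (Setting.ofFrames n lat sig split qData
      (V.toRealFrames thetaBox qCentre) hq hadm hfin).possibleImages j vQ) := h.1
  show (S.D n).logvol j vQ (((V.frameK j vQ).comap (V.e j vQ)).hull _) = _
  rw [hV.logvol_eq, HullFrame.comap_hull _ _ hb, hhull]
  exact V.logvol_preimage_pi j vQ fun i => ⟨0, mem_closedBall_self (hr i)⟩

/-- **Nonarchimedean packets**: with `frameK = HullFrame.ofLocalFields` (c312-7 `Cor312HullFrameReal`), under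
`HullDefined` the local `−|log(Θ)|` is `Σ_i w_i·μ^log_{K_i}(B(0, sup_{u ∈ e(⋃ possible images)} ‖u_i‖))` — the log-volume of
"the smallest subset of the form `λ·𝒪_{(−)}` that contains" the union ([IUTchIII] Rmk. 3.9.5 (i) p. 127; S2
`holomorphicHull` = the polydisc of the radii). [claim: Mochizuki2012, status: disputed] -/
theorem thetaLocal_ofFrames_ofLocalFields (hV : V.Realizes (S.D n)) (j : T.Label) (vQ : T.VQ)
    [∀ i, IsUltrametricDist (V.K j vQ i)] [∀ i, ProperSpace (V.K j vQ i)]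
    (hF : V.frameK j vQ = HullFrame.ofLocalFields (V.K j vQ))
    (h : (Setting.ofFrames n lat sig split qData (V.toRealFrames thetaBox qCentre) hq hadm hfin).HullDefined j vQ) :
    (Setting.ofFrames n lat sig split qData (V.toRealFrames thetaBox qCentre) hq hadm hfin).thetaLocal j vQ =
      ((∑ i, V.w j vQ i * (V.vol j vQ i).logvol (closedBall 0
        (hullRadius (V.K j vQ) (V.e j vQ '' ⋃₀ (Setting.ofFrames n lat sig split qData
          (V.toRealFrames thetaBox qCentre) hq hadm hfin).possibleImages j vQ) i)) : ℝ) : WithTop ℝ) := by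
  have hb : Bornology.IsBounded (V.e j vQ '' ⋃₀ (Setting.ofFrames n lat sig split qData
      (V.toRealFrames thetaBox qCentre) hq hadm hfin).possibleImages j vQ) := by
    have h1 := h.1
    change (V.frameK j vQ).IsBounded _ at h1
    rw [hF] at h1
    exact h1
  have hnd : IsNondegenerate (V.K j vQ) (V.e j vQ '' ⋃₀ (Setting.ofFrames n lat sig split qData
      (V.toRealFrames thetaBox qCentre) hq hadm hfin).possibleImages j vQ) := by
    have h2 := h.2
    change (V.frameK j vQ).HasHull _ at h2
    rw [hF] at h2
    exact h2
  refine thetaLocal_ofFrames_of_hull_eq_polydisc lat sig split qData thetaBox qCentre hq hadm hfin hV j vQ h _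
    (fun i => hullRadius_nonneg _ _ i) ?_
  rw [hF, HullFrame.ofLocalFields_hull_eq _ hb hnd, holomorphicHull_of_isBounded _ hb]

/-- **Archimedean packets**: with `frameK = HullFrame.ofNormSurjective` (c312-7 `Cor312HullFrameArch`: every
nonnegative real is a norm, e.g. `ℂ`), under `HullDefined` the same closed form holds, the factor volume being the
RADIAL one ([AbsTopIII] Prop. 5.7 (ii); [IUTchIII] Prop. 3.9 (i) p. 116). [claim: Mochizuki2012, status: disputed] -/
theorem thetaLocal_ofFrames_ofNormSurjective (hV : V.Realizes (S.D n)) (j : T.Label) (vQ : T.VQ)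
    (hK : HullFrame.NormSurjective (V.K j vQ)) (hF : V.frameK j vQ = HullFrame.ofNormSurjective (V.K j vQ) hK)
    (h : (Setting.ofFrames n lat sig split qData (V.toRealFrames thetaBox qCentre) hq hadm hfin).HullDefined j vQ) :
    (Setting.ofFrames n lat sig split qData (V.toRealFrames thetaBox qCentre) hq hadm hfin).thetaLocal j vQ =
      ((∑ i, V.w j vQ i * (V.vol j vQ i).logvol (closedBall 0
        (hullRadius (V.K j vQ) (V.e j vQ '' ⋃₀ (Setting.ofFrames n lat sig split qData
          (V.toRealFrames thetaBox qCentre) hq hadm hfin).possibleImages j vQ) i)) : ℝ) : WithTop ℝ) := by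
  have hb : Bornology.IsBounded (V.e j vQ '' ⋃₀ (Setting.ofFrames n lat sig split qData
      (V.toRealFrames thetaBox qCentre) hq hadm hfin).possibleImages j vQ) := by
    have h1 := h.1
    change (V.frameK j vQ).IsBounded _ at h1
    rw [hF] at h1
    exact h1
  have hnd : IsNondegenerate (V.K j vQ) (V.e j vQ '' ⋃₀ (Setting.ofFrames n lat sig split qData
      (V.toRealFrames thetaBox qCentre) hq hadm hfin).possibleImages j vQ) := by
    have h2 := h.2
    change (V.frameK j vQ).HasHull _ at h2
    rw [hF] at h2
    exact h2
  refine thetaLocal_ofFrames_of_hull_eq_polydisc lat sig split qData thetaBox qCentre hq hadm hfin hV j vQ h _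
    (fun i => hullRadius_nonneg _ _ i) ?_
  rw [hF, HullFrame.ofNormSurjective_hull_eq _ hK hb hnd, holomorphicHull_of_isBounded _ hb]

/-- The possible images all lie below the hull in log-volume, packet by packet (the skeleton's
`logvol_U_le_negLogTheta` at one packet, for these volumes): for an admissible possible image `U` at `(j, v_ℚ)`
under `HullDefined`, `logvol(U) ≤ logvol(thetaHull)`. [folklore] -/
theorem logvol_possibleImage_le_thetaHull (hV : V.Realizes (S.D n)) (j : T.Label) (vQ : T.VQ)
    (h : (Setting.ofFrames n lat sig split qData (V.toRealFrames thetaBox qCentre) hq hadm hfin).HullDefined j vQ)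
    {U : Set (S.L.Packet j vQ)}
    (hU : U ∈ (Setting.ofFrames n lat sig split qData (V.toRealFrames thetaBox qCentre) hq hadm hfin).possibleImages
      j vQ)
    (hUadm : (S.D n).Adm j vQ U) :
    (S.D n).logvol j vQ U ≤ (S.D n).logvol j vQ
      ((Setting.ofFrames n lat sig split qData (V.toRealFrames thetaBox qCentre) hq hadm hfin).thetaHull j vQ) := by
  have hadm' : (S.D n).Adm j vQ
      ((Setting.ofFrames n lat sig split qData (V.toRealFrames thetaBox qCentre) hq hadm hfin).thetaHull j vQ) :=
    (Setting.ofFrames n lat sig split qData (V.toRealFrames thetaBox qCentre) hq hadm hfin).thetaHull_adm h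
  rw [hV.logvol_eq, hV.logvol_eq]
  exact V.logvol_mono ((hV.adm_iff j vQ U).1 hUadm) ((hV.adm_iff j vQ _).1 hadm')
    ((Set.subset_sUnion_of_mem hU).trans (((Setting.ofFrames n lat sig split qData
      (V.toRealFrames thetaBox qCentre) hq hadm hfin).frame j vQ).subset_hull _))

end FrameVolumePieces

end Cor312Vol

end IUTFork

end Summit.ABC

end
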